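import Summits.Ventures.PackingBounds.Configurations.ListConfig
import Summits.Ventures.PackingBounds.Configurations.TribonacciInt

/-!
# The snub cube: `24` points on `S²` with minimal angle `43.6908°` (Tammes `N = 24`, attained side), over `ℤ[τ]`

Framing: lottery ticket; floor = certified bounds/negative ranges. Venture `PackingBounds` (cell
`pub-packcert`, seat `pub-packcert-recog`, target T3 = Cohn–de Laat–Leijenhorst 2024 Conj. 1.4 on the
three-point bound for the snub cube) — the **attained side** of the Tammes problem for `N = 24`.

The `24` vertices of the snub cube are the even permutations of `(±1, ±1/τ, ±τ)` with an even number of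
minus signs together with the odd permutations with an odd number of minus signs, `τ = 1.8392867…` the
tribonacci constant (`τ³ = τ² + τ + 1`, so `1/τ = τ² - τ - 1 ∈ ℤ[τ]`). All coordinates lie in `ℤ[τ]`
(`Configurations/TribonacciInt.lean`), the common squared length is `q = 1 + 2τ`, and the kernel computes
the `24 · 23` dot products exactly in `ℤ[τ]`: every vertex sees the same distance distribution with `11`
values, the largest being `τ²` with multiplicity `5` (the five neighbours in the snub cube), i.e. cosine
`τ²/(1 + 2τ) = (τ² + 2τ - 2)/7 = 0.72307846…` (minimal polynomial `7x³ + x² - 3x - 1`), angle `43.6908°` —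
Robinson's value for the Tammes problem with `24` points. Consequences (Mathlib-only statements):
`exists_code_24` (exact form, `A(3, (t² + 2t - 2)/7) ≥ 24` for the real root `t` of `t³ = t² + t + 1`) and
`exists_code_24_rat` (`24` unit vectors of `ℝ³` with pairwise inner products `≤ 0.723079`, i.e.
`θ(24) ≥ arccos 0.723079 > 43.6907°`). Optimality (Robinson 1961) is not asserted here.

## References
* R. M. Robinson, *Arrangement of 24 points on a sphere*, Math. Ann. 144 (1961) 17–48. [`Robinson1961`]
* H. Cohn, D. de Laat, N. Leijenhorst, *Optimality of spherical codes via exact semidefinite programming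
  bounds*, arXiv:2403.16874 (2024), Conj. 1.4. [`CohnDelaatLeijenhorst2024`]
-/

namespace Summit.Ventures.PackingBounds.Config.SnubCube

open Finset Summit.Ventures.PackingBounds.Config Summit.Ventures.PackingBounds.Config.TribInt

/-- The `24` vertices `σ(±1, ±1/τ, ±τ)` of the snub cube with coordinates in `ℤ[τ]` (`1/τ = ⟨-1, -1, 1⟩`,
`τ = ⟨0, 1, 0⟩`): even permutations with an even number of minus signs, odd permutations with an odd number.
[cite: Robinson1961, §1] -/
def vecs : List (List TribInt) := [
  [⟨1, 0, 0⟩, ⟨-1, -1, 1⟩, ⟨0, 1, 0⟩],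
  [⟨1, 0, 0⟩, ⟨1, 1, -1⟩, ⟨0, -1, 0⟩],
  [⟨-1, 0, 0⟩, ⟨-1, -1, 1⟩, ⟨0, -1, 0⟩],
  [⟨-1, 0, 0⟩, ⟨1, 1, -1⟩, ⟨0, 1, 0⟩],
  [⟨-1, -1, 1⟩, ⟨0, 1, 0⟩, ⟨1, 0, 0⟩],
  [⟨-1, -1, 1⟩, ⟨0, -1, 0⟩, ⟨-1, 0, 0⟩],
  [⟨1, 1, -1⟩, ⟨0, 1, 0⟩, ⟨-1, 0, 0⟩],
  [⟨1, 1, -1⟩, ⟨0, -1, 0⟩, ⟨1, 0, 0⟩],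
  [⟨0, 1, 0⟩, ⟨1, 0, 0⟩, ⟨-1, -1, 1⟩],
  [⟨0, 1, 0⟩, ⟨-1, 0, 0⟩, ⟨1, 1, -1⟩],
  [⟨0, -1, 0⟩, ⟨1, 0, 0⟩, ⟨1, 1, -1⟩],
  [⟨0, -1, 0⟩, ⟨-1, 0, 0⟩, ⟨-1, -1, 1⟩],
  [⟨1, 0, 0⟩, ⟨0, 1, 0⟩, ⟨1, 1, -1⟩],
  [⟨1, 0, 0⟩, ⟨0, -1, 0⟩, ⟨-1, -1, 1⟩],
  [⟨-1, 0, 0⟩, ⟨0, 1, 0⟩, ⟨-1, -1, 1⟩],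
  [⟨-1, 0, 0⟩, ⟨0, -1, 0⟩, ⟨1, 1, -1⟩],
  [⟨0, 1, 0⟩, ⟨-1, -1, 1⟩, ⟨-1, 0, 0⟩],
  [⟨0, 1, 0⟩, ⟨1, 1, -1⟩, ⟨1, 0, 0⟩],
  [⟨0, -1, 0⟩, ⟨-1, -1, 1⟩, ⟨1, 0, 0⟩],
  [⟨0, -1, 0⟩, ⟨1, 1, -1⟩, ⟨-1, 0, 0⟩],
  [⟨-1, -1, 1⟩, ⟨1, 0, 0⟩, ⟨0, -1, 0⟩],
  [⟨-1, -1, 1⟩, ⟨-1, 0, 0⟩, ⟨0, 1, 0⟩],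
  [⟨1, 1, -1⟩, ⟨1, 0, 0⟩, ⟨0, 1, 0⟩],
  [⟨1, 1, -1⟩, ⟨-1, 0, 0⟩, ⟨0, -1, 0⟩]]

/-- The common squared length `q = 1 + 1/τ² + τ² = 1 + 2τ`. -/
def q : TribInt := ⟨1, 2, 0⟩

/-- The distance table (dot products of a vertex with the `23` others, increasing, with multiplicities):
`11` values in `ℤ[τ]`; the largest, `τ² = ⟨0, 0, 1⟩`, has multiplicity `5` (the five neighbours). -/
def table : List (TribInt × ℕ) := [(⟨2, 2, -3⟩, 1), (⟨-1, 2, -2⟩, 1), (⟨0, -4, 1⟩, 1), (⟨-3, 0, 0⟩, 1),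
  (⟨1, -2, 0⟩, 1), (⟨-2, -2, 1⟩, 3), (⟨2, 0, -1⟩, 2), (⟨0, 2, -1⟩, 4), (⟨1, 0, 0⟩, 3), (⟨-1, -2, 2⟩, 1),
  (⟨0, 0, 1⟩, 5)]

/-- Kernel check: `24` coordinate lists. -/
theorem length_vecs : vecs.length = 24 := by decide +kernel

set_option maxRecDepth 100000 in
/-- Kernel check: every list has length `3` and squared length `q`. -/
private theorem shape_vecs : shapeOK vecs 3 q = true := by decide +kernel

/-- Kernel check: the table keys are distinct and differ from `q`. -/
private theorem keys_table : keysOK table q = true := by decide +kernel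

set_option maxRecDepth 100000 in
/-- Kernel check (the distance distribution in `ℤ[τ]`): the dot products of every vertex with the other
vertices have exactly the tabulated multiplicities and take no other value. -/
private theorem hist_vecs : histOK vecs table vecs = true := by decide +kernel

/-- The coordinate lists are pairwise distinct (from the checks). -/
private theorem nodup_vecs : vecs.Nodup := nodup_of_checks shape_vecs keys_table hist_vecs

/-- The configuration: the normalised vertices as points of `ℝ³`. -/
noncomputable def pts : Finset (EuclideanSpace ℝ (Fin 3)) := config toReal 3 q vecs

/-- `ι q = 1 + 2 tau > 0`. -/
private theorem hq : 0 < toReal q := by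
  rw [toReal_apply, q]; push_cast; nlinarith [tau_gt]

/-- Every key `d` of the table satisfies `ι d / ι q ≤ (tau² + 2 tau - 2)/7` (`= tau²/(1 + 2 tau)`, the
largest key). -/
private theorem keys_le : ∀ p ∈ table, toReal p.1 / toReal q ≤ (tau ^ 2 + 2 * tau - 2) / 7 := by
  have h1 := tau_gt; have h2 := tau_lt; have h3 := tau_cubic
  intro p hp
  rw [div_le_div_iff₀ hq (by norm_num : (0 : ℝ) < 7), toReal_apply, toReal_apply, q]
  simp only [table, List.mem_cons, List.not_mem_nil, or_false] at hp
  rcases hp with rfl | rfl | rfl | rfl | rfl | rfl | rfl | rfl | rfl | rfl | rfl <;>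
    push_cast <;> nlinarith

/-- `(tau² + 2 tau - 2)/7 < 0.723079` (so in particular `< 1`). -/
private theorem smax_lt : (tau ^ 2 + 2 * tau - 2) / 7 < 0.723079 := by
  nlinarith [tau_gt, tau_lt]

/-- `pts` has `24` points: distinct lists give distinct unit vectors because their inner product is
`≤ (tau² + 2 tau - 2)/7 < 1`. -/
theorem card_pts : pts.card = 24 := by
  rw [pts, config, ← length_vecs, List.toFinset_card_of_nodup, List.length_map]
  refine nodup_vecs.map_on fun l hl l' hl' he => ?_
  by_contra hne
  obtain ⟨p, hp, hpe⟩ := inner_vec_mem hq shape_vecs hist_vecs hl hl' hne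
  rw [he, real_inner_self_eq_norm_sq, norm_vec toReal 3 q hq l' (length_of_shapeOK shape_vecs hl')
    (dot_self_of_shapeOK shape_vecs hl'), one_pow] at hpe
  have h := keys_le p hp
  rw [← hpe] at h
  linarith [smax_lt]

/-- Every point of `pts` is a unit vector. -/
theorem norm_pts : ∀ x ∈ pts, ‖x‖ = 1 := norm_eq_one hq shape_vecs

/-- Pairwise inner products of `pts` are `≤ (tau² + 2 tau - 2)/7 = 0.7230784…`. -/
theorem inner_pts : ∀ x ∈ pts, ∀ y ∈ pts, x ≠ y → inner ℝ x y ≤ (tau ^ 2 + 2 * tau - 2) / 7 :=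
  inner_le hq shape_vecs hist_vecs _ keys_le

/-- **Tammes `N = 24`, attained side (exact form): `A(3, (t² + 2t - 2)/7) ≥ 24`** for the real root `t` of
`t³ = t² + t + 1` — there are `24` unit vectors in `ℝ³` (the vertices of the snub cube) with pairwise inner
products at most `(t² + 2t - 2)/7 = 0.72307846…`, i.e. pairwise angles at least `43.6908°`.
[cite: Robinson1961, §1] -/
theorem exists_code_24 : ∃ t : ℝ, 1 < t ∧ t ^ 3 = t ^ 2 + t + 1 ∧
    ∃ C : Finset (EuclideanSpace ℝ (Fin 3)), C.card = 24 ∧ (∀ x ∈ C, ‖x‖ = 1) ∧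
      ∀ x ∈ C, ∀ y ∈ C, x ≠ y → inner ℝ x y ≤ (t ^ 2 + 2 * t - 2) / 7 :=
  ⟨tau, by linarith [tau_gt], tau_cubic, pts, card_pts, norm_pts, inner_pts⟩

/-- **Tammes `N = 24`, attained side (rational form): `24` unit vectors of `ℝ³` with pairwise inner products
`≤ 0.723079`** (so `θ(24) ≥ arccos 0.723079 > 43.6907°`). [cite: Robinson1961, §1] -/
theorem exists_code_24_rat : ∃ C : Finset (EuclideanSpace ℝ (Fin 3)), C.card = 24 ∧ (∀ x ∈ C, ‖x‖ = 1) ∧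
    ∀ x ∈ C, ∀ y ∈ C, x ≠ y → inner ℝ x y ≤ 0.723079 :=
  ⟨pts, card_pts, norm_pts, fun x hx y hy hxy => (inner_pts x hx y hy hxy).trans smax_lt.le⟩

/-- **`A(3, arccos s) ≥ 24` for every `s ≥ 0.723079`.** -/
theorem exists_code_24_of_le {s : ℝ} (hs : (0.723079 : ℝ) ≤ s) :
    ∃ C : Finset (EuclideanSpace ℝ (Fin 3)), C.card = 24 ∧ (∀ x ∈ C, ‖x‖ = 1) ∧
      ∀ x ∈ C, ∀ y ∈ C, x ≠ y → inner ℝ x y ≤ s := by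
  obtain ⟨C, hc, hn, hi⟩ := exists_code_24_rat
  exact ⟨C, hc, hn, fun x hx y hy hxy => (hi x hx y hy hxy).trans hs⟩

end Summit.Ventures.PackingBounds.Config.SnubCube
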